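import Mathlib
import Summits.Ventures.HodgeRepro2.Tier7.Line3.NumeratorNorm

/-!
# Tier7/Line3/NumeratorNormDefinite — the archimedean size with the definite places absorbed
(seat t7-x1, gen 4; the «(1,1)-places comparison» of NumeratorNorm's [W] sentence)

LINE 3 (t7-plan-3), version (ii). NumeratorNorm bounds the numerator's norm by `|N(m)| · ∏_{w | ∞} (1 + w x)^{mult w}` over
ALL infinite places; DominantSideOfKappa's `size` sees the (1,1)-places only, the definite place `ι₁` carrying `|κ|_{ι₁} ≤ 1`
(KappaDefiniteBound p666869). This module absorbs a set `D` of places where `w x ≤ 1` into a constant: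
`prod_one_add_le_of_le : (∀ w ∈ D, w x ≤ B) → ∏_{w} (1 + w x)^{mult w} ≤ (1 + B)^{∑_{w ∈ D} mult w} · ∏_{w ∉ D} (1 + w x)^{mult w}`
(`B` displayed — plan-3 STATUS l. 15998: `B = 1` for `κ`, `B = 2` for `κ − 1` at a definite place), the composed bound
`absNorm_span_le_of_le : N(span {a}) ≤ |N(m)| · (1 + B)^{∑_{w ∈ D} mult w} · ∏_{w ∉ D} (1 + w x)^{mult w}`, and its case `B = 1`
(`absNorm_span_le_of_le_one`, factor `2^{∑_{D} mult}`).
DICTIONARY (in words): `K = E⁺` (totally real, `mult = 1`), `D = {ι₁}` the definite place with `|κ|_{ι₁} ≤ 1` on `Orb`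
(KappaDefiniteBound), so `N(I γ) ≤ 2 |N(M)| (1 + |κ|_{ι₂})(1 + |κ|_{ι₃})` — the dominance `size` up to the constant `2 |N(M)|`.
Nothing here is about (N), (P), the real `X`, or HC_CM; §8(d): NO. Blind lane: Mathlib + the HodgeRepro2 prefix; no sorry;
axioms ⊆ {propext, Classical.choice, Quot.sound}.
-/

namespace Summit.Ventures.HodgeRepro2.Tier7.Line3.NumeratorNorm

open NumberField
open scoped NumberField

variable {K : Type*} [Field K] [NumberField K]

open scoped Classical in
/-- **the bounded places absorbed**: on a set `D` of places where `w x ≤ B`, the factor `(1 + w x)^{mult}` is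
`≤ (1 + B)^{mult}` (plan-3 STATUS l. 15998: `B = 1` for `κ` at the definite place, `B = 2` for `κ − 1`). -/
theorem prod_one_add_le_of_le (x : K) (D : Finset (InfinitePlace K)) {B : ℝ} (hD : ∀ w ∈ D, w x ≤ B) :
    ∏ w : InfinitePlace K, (1 + w x) ^ w.mult ≤
      (1 + B) ^ (∑ w ∈ D, w.mult) * ∏ w ∈ Finset.univ \ D, (1 + w x) ^ w.mult := by
  have hsplit : ∏ w : InfinitePlace K, (1 + w x) ^ w.mult =
      (∏ w ∈ D, (1 + w x) ^ w.mult) * ∏ w ∈ Finset.univ \ D, (1 + w x) ^ w.mult := by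
    rw [← Finset.prod_sdiff (Finset.subset_univ D), mul_comm]
  have hD' : ∏ w ∈ D, (1 + w x) ^ w.mult ≤ (1 + B) ^ (∑ w ∈ D, w.mult) := by
    rw [← Finset.prod_pow_eq_pow_sum]
    apply Finset.prod_le_prod
    · intro w _
      exact pow_nonneg (by linarith [apply_nonneg w x]) _
    · intro w hw
      exact pow_le_pow_left₀ (by linarith [apply_nonneg w x]) (by linarith [hD w hw]) _
  rw [hsplit]
  exact mul_le_mul_of_nonneg_right hD'
    (Finset.prod_nonneg fun w _ => pow_nonneg (by linarith [apply_nonneg w x]) _)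

open scoped Classical in
/-- **the numerator's norm against the size of the remaining places**: `N(span {a}) ≤ |N(m)| · (1 + B)^{∑_{w ∈ D} mult w} ·
∏_{w ∉ D} (1 + w x)^{mult w}` when `w x ≤ B` on `D`. -/
theorem absNorm_span_le_of_le (x : K) (a m : 𝓞 K) (h : (a : K) = (m : K) * x)
    (D : Finset (InfinitePlace K)) {B : ℝ} (hD : ∀ w ∈ D, w x ≤ B) :
    (Ideal.absNorm (Ideal.span {a}) : ℝ) ≤
      ((|Algebra.norm ℚ (m : K)| : ℚ) : ℝ) * ((1 + B) ^ (∑ w ∈ D, w.mult) *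
        ∏ w ∈ Finset.univ \ D, (1 + w x) ^ w.mult) :=
  (absNorm_span_le x a m h).trans
    (mul_le_mul_of_nonneg_left (prod_one_add_le_of_le x D hD) (by positivity))

open scoped Classical in
/-- the definite-place case `B = 1`: the factor `2^{∑_{w ∈ D} mult w}`. -/
theorem absNorm_span_le_of_le_one (x : K) (a m : 𝓞 K) (h : (a : K) = (m : K) * x)
    (D : Finset (InfinitePlace K)) (hD : ∀ w ∈ D, w x ≤ 1) :
    (Ideal.absNorm (Ideal.span {a}) : ℝ) ≤
      ((|Algebra.norm ℚ (m : K)| : ℚ) : ℝ) * ((2 : ℝ) ^ (∑ w ∈ D, w.mult) *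
        ∏ w ∈ Finset.univ \ D, (1 + w x) ^ w.mult) := by
  have h2 : (1 + (1 : ℝ)) = 2 := by norm_num
  rw [← h2]
  exact absNorm_span_le_of_le x a m h D hD

end Summit.Ventures.HodgeRepro2.Tier7.Line3.NumeratorNorm
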